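import Literature.MathematicalPhysics.QuantumLattice.HubbardFermiSeaTangentRowsPositiveTPrime
import Literature.MathematicalPhysics.QuantumLattice.HubbardTTPrimeParticleHoleImageWords
import Literature.MathematicalPhysics.QuantumLattice.HubbardTTPrimeDiagHopTransport
import Literature.MathematicalPhysics.QuantumLattice.TypeClassSidecarReaderTPrimeTransport
import Literature.MathematicalPhysics.QuantumLattice.TorusSectorGibbsMixture
import HarnessLib

/-!
# Ventures/CertifiedManyBodySolver — KERNEL LOWER EDGES (no claim node) for the electron-doped NCCO cells on the filling interval
# `n ∈ [109/100, 117/100]`: the point `(t′, U) = (−1/4, 8)` and the NCCO #20 object-M `(t′, U)`-box, every `β`, every torus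

HONEST FRAMING: first certified bounds; not a superconductivity verdict; every number certified or labelled float.
WHAT THIS IS NOT: not a phase sentence; LOWER energy edges only, UNCONDITIONAL kernel theorems (no certificate node): the Fermi-sea tangent row at the
particle–hole image point `(t′, n) = (+1/4, ·)` (`fermiSeaTangentRow_tPrime_one_div_four_at_seven_div_eight`: `e₀(1, 1/4, U, m) ≥ −1.8818630531 + (835/4096)·m`
for EVERY density `m` and every `U ≥ 0` — a tangent of the convex free band), the exact one-band particle–hole identity
`e₀(1, s, U, n) = e₀(1, −s, U, 2 − n) + U(n − 1)` (`energyDensityTT'_ge_of_particleHole_image`), the kinematic `t′`-Lipschitz bound `16/π² ≤ 1.6212`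
(`energyDensityTT'_ge_of_lowerBound_tPrime_kinematic`) and thermal ≥ ground (`IsTorusLimitOfMixture.energyDensityTT'_le_meanEnergy_of_sectorGibbs`, ANY `β`,
ANY `Ls`). Companion of `HubbardSquare_nbox_edoped_tpm1o4_thermal_<β>_PHretype3x3_j273931` (the C1+C2 / C2-only UPPER edges on every torus); together they are
WINDOWS. Seat hubbard-downfold-unc-2 (pub/hubbard-downfold, FILLING direction, electron-doped half), 2026-08-27; zero solves, zero kit.

HENCE (10-dp outward): `e₀(1, −1/4, U, n) ≥ −1.8818630531 + (835/4096)(2 − n) + U(n − 1)` for every `U ≥ 0`, `0 < n < 2` (`edoped_ground_floor_PH`); at hopping `s`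
with `|−s − 1/4| ≤ σ` the same minus `1.6212·σ` (`edoped_ground_floor_PH_tPrime`); thermal lower edges on the cells: POINT `(−1/4, 8)` × `[1.09, 1.17]`:
`e(ω) ≥ −1.8818630531 + (835/4096)(2 − n) + 8(n − 1) ≥ −0.9763527992`; NCCO object-M low piece `[−269/1000, −21/125] × [181/100, 8] × [1.09, 1.17]`: `e(ω) ≥ −1.6663911992`;
high sliver `[8, 867/100]`: `e(ω) ≥ −1.1092911992` (the floor is increasing in `U` and in `n` on these cells, so it binds at the low corner).
[cite: LiebWuPhysicaA2003, §1 eq. (3)] [cite: LiebLoss1993, §8, Theorem 8.2] [cite: Israel1979, Thm. I.3.4] [cite: Ruelle1969, §3.4]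
Seat prover-hubbard-downfold-unc-2-g9, 2026-08-27.
-/

noncomputable section

namespace Summit.Ventures.CertifiedManyBodySolver.Certificates

open Literature.MathematicalPhysics.QuantumLattice
open Literature.MathematicalPhysics.QuantumLattice.ThermodynamicLimit
open Literature.MathematicalPhysics.QuantumLattice.InfVolFermionState
open Literature.Probability.LatticeModels
open _root_.Filter
open scoped ComplexOrder

/-- **Electron-doped ground-state floor at `t′ = −1/4` by particle–hole**, every `U ≥ 0`, every `0 < n < 2`:
`−1.8818630531 + (835/4096)(2 − n) + U(n − 1) ≤ e₀(1, −1/4, U, n)` (Fermi-sea tangent row at the image hopping `+1/4` read at `2 − n`).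
[cite: LiebWuPhysicaA2003, §1 eq. (3)] [cite: LiebLoss1993, §8, Theorem 8.2] -/
theorem edoped_ground_floor_PH {U n : ℝ} (hU : 0 ≤ U) (hn0 : 0 < n) (hn2 : n < 2) :
    (-1.8818630531 : ℝ) + 835 / 4096 * (2 - n) + U * (n - 1) ≤ energyDensityTT' 1 (-1 / 4) U n := by
  have himg : (-1.8818630531 : ℝ) + 835 / 4096 * (2 - n) ≤ energyDensityTT' 1 (-(-1 / 4)) U (2 - n) := by
    rw [show (-(-1 / 4) : ℝ) = 1 / 4 by norm_num]
    exact fermiSeaTangentRow_tPrime_one_div_four_at_seven_div_eight hU (n := 2 - n) (by linarith) (by linarith)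
  have h := energyDensityTT'_ge_of_particleHole_image 1 (-1 / 4) hU hn0 hn2 himg
  linarith

/-- **… at any hopping `s` with `|(−s) − 1/4| ≤ σ`** (kinematic `t′`-Lipschitz `16/π² ≤ 1.6212` on the image side):
`−1.8818630531 + (835/4096)(2 − n) − 1.6212·σ + U(n − 1) ≤ e₀(1, s, U, n)`. [cite: LiebWuPhysicaA2003, §1 eq. (3)] [cite: Israel1979, Thm. I.3.4] -/
theorem edoped_ground_floor_PH_tPrime {s σ U n : ℝ} (hσ : |(-s) - 1 / 4| ≤ σ) (hU : 0 ≤ U) (hn0 : 0 < n) (hn2 : n < 2) :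
    (-1.8818630531 : ℝ) + 835 / 4096 * (2 - n) - 16212 / 10000 * σ + U * (n - 1) ≤ energyDensityTT' 1 s U n := by
  have h0 : (-1.8818630531 : ℝ) + 835 / 4096 * (2 - n) ≤ energyDensityTT' 1 (1 / 4) U (2 - n) :=
    fermiSeaTangentRow_tPrime_one_div_four_at_seven_div_eight hU (n := 2 - n) (by linarith) (by linarith)
  have h1 := energyDensityTT'_ge_of_lowerBound_tPrime_kinematic 1 hU (n := 2 - n) (by linarith) (by linarith) (s' := -s) h0
  have hK := sixteen_div_pi_sq_lt
  have hKσ : 16 / Real.pi ^ 2 * |(-s) - 1 / 4| ≤ 16212 / 10000 * σ :=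
    mul_le_mul hK.le hσ (abs_nonneg _) (by norm_num)
  have himg : (-1.8818630531 : ℝ) + 835 / 4096 * (2 - n) - 16212 / 10000 * σ ≤ energyDensityTT' 1 (-s) U (2 - n) := by
    linarith
  have h := energyDensityTT'_ge_of_particleHole_image 1 s hU hn0 hn2 himg
  linarith

/-! ### Thermal lower edges on the electron-doped cells (ANY `β`, ANY `Ls`, no parity, no node) -/

/-- **POINT `(t′, U) = (−1/4, 8)`, n-resolved**: `−1.8818630531 + (835/4096)(2 − n) + 8(n − 1) ≤ e(ω)` for every torus limit of the canonical class at
`(β, 1, −1/4, 8, n)`, every `0 < n < 2` (thermal ≥ ground ≥ the particle–hole Fermi-sea floor). [cite: Ruelle1969, §3.4] [cite: LiebWuPhysicaA2003, §1 eq. (3)] -/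
theorem edopedCell_thermal_lower_edPoint_affine {β n : ℝ} (hn0 : 0 < n) (hn2 : n < 2)
    {ω : InfVolFermionState 2} {Ls : ℕ → ℕ} (hLs : Tendsto Ls atTop atTop)
    (h : ω.IsTorusLimitOfMixture (sectorGibbsCount n) (fun L => sectorGibbsWeightTT' β 1 (-1 / 4) 8 n L)
      (fun L => sectorGibbsVectorTT' 1 (-1 / 4) 8 n L) Ls) :
    (-1.8818630531 : ℝ) + 835 / 4096 * (2 - n) + 8 * (n - 1) ≤ ω.meanEnergy (hubbardTTPrimeFermionInteraction 1 (-1 / 4) 8) 1 :=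
  (edoped_ground_floor_PH (U := 8) (by norm_num) hn0 hn2).trans
    (h.energyDensityTT'_le_meanEnergy_of_sectorGibbs 1 (-1 / 4) 8 (n := n) hn0.le hn2 β hLs (-1 / 4) (U'' := 8) (by norm_num))

/-- **POINT `(−1/4, 8)` × `n ∈ [109/100, 117/100]`**: `−0.9763527992 ≤ e(ω)` (the affine floor at `n = 109/100`).
[cite: Ruelle1969, §3.4] [cite: LiebWuPhysicaA2003, §1 eq. (3)] -/
theorem edopedCell_thermal_lower_edPoint {β n : ℝ} (hn1 : 109 / 100 ≤ n) (hn2 : n ≤ 117 / 100)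
    {ω : InfVolFermionState 2} {Ls : ℕ → ℕ} (hLs : Tendsto Ls atTop atTop)
    (h : ω.IsTorusLimitOfMixture (sectorGibbsCount n) (fun L => sectorGibbsWeightTT' β 1 (-1 / 4) 8 n L)
      (fun L => sectorGibbsVectorTT' 1 (-1 / 4) 8 n L) Ls) :
    (-0.9763527992 : ℝ) ≤ ω.meanEnergy (hubbardTTPrimeFermionInteraction 1 (-1 / 4) 8) 1 := by
  have h1 := edopedCell_thermal_lower_edPoint_affine (by linarith) (by linarith) hLs h
  linarith

/-- **NCCO object-M low piece `[−269/1000, −21/125] × [181/100, 8] × [109/100, 117/100]`**: `−1.6663911992 ≤ e(ω)` for every torus limit at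
`(β, 1, s, U, n)` in the piece (floor increasing in `U` and `n`; `σ = 41/500` from the image anchor `+1/4`). [cite: Ruelle1969, §3.4] [cite: LiebWuPhysicaA2003, §1 eq. (3)] -/
theorem edopedCell_thermal_lower_edBoxLow {β s U n : ℝ} (hs1 : -269 / 1000 ≤ s) (hs2 : s ≤ -21 / 125) (hU1 : 181 / 100 ≤ U)
    (_hU2 : U ≤ 8) (hn1 : 109 / 100 ≤ n) (hn2 : n ≤ 117 / 100)
    {ω : InfVolFermionState 2} {Ls : ℕ → ℕ} (hLs : Tendsto Ls atTop atTop)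
    (h : ω.IsTorusLimitOfMixture (sectorGibbsCount n) (fun L => sectorGibbsWeightTT' β 1 s U n L)
      (fun L => sectorGibbsVectorTT' 1 s U n L) Ls) :
    (-1.6663911992 : ℝ) ≤ ω.meanEnergy (hubbardTTPrimeFermionInteraction 1 s U) 1 := by
  have hσ : |(-s) - 1 / 4| ≤ 41 / 500 := abs_le.2 ⟨by linarith, by linarith⟩
  have hg := edoped_ground_floor_PH_tPrime hσ (U := U) (by linarith) (n := n) (by linarith) (by linarith)
  have hth := h.energyDensityTT'_le_meanEnergy_of_sectorGibbs 1 s U (n := n) (by linarith) (by linarith) β hLs s (U'' := U)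
    (by linarith)
  nlinarith [hg, hth, mul_nonneg (sub_nonneg.2 hU1) (sub_nonneg.2 hn1), hn2]

/-- **NCCO object-M high sliver `[−269/1000, −21/125] × [8, 867/100] × [109/100, 117/100]`**: `−1.1092911992 ≤ e(ω)`.
[cite: Ruelle1969, §3.4] [cite: LiebWuPhysicaA2003, §1 eq. (3)] -/
theorem edopedCell_thermal_lower_edBoxHigh {β s U n : ℝ} (hs1 : -269 / 1000 ≤ s) (hs2 : s ≤ -21 / 125) (hU1 : 8 ≤ U)
    (_hU2 : U ≤ 867 / 100) (hn1 : 109 / 100 ≤ n) (hn2 : n ≤ 117 / 100)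
    {ω : InfVolFermionState 2} {Ls : ℕ → ℕ} (hLs : Tendsto Ls atTop atTop)
    (h : ω.IsTorusLimitOfMixture (sectorGibbsCount n) (fun L => sectorGibbsWeightTT' β 1 s U n L)
      (fun L => sectorGibbsVectorTT' 1 s U n L) Ls) :
    (-1.1092911992 : ℝ) ≤ ω.meanEnergy (hubbardTTPrimeFermionInteraction 1 s U) 1 := by
  have hσ : |(-s) - 1 / 4| ≤ 41 / 500 := abs_le.2 ⟨by linarith, by linarith⟩
  have hg := edoped_ground_floor_PH_tPrime hσ (U := U) (by linarith) (n := n) (by linarith) (by linarith)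
  have hth := h.energyDensityTT'_le_meanEnergy_of_sectorGibbs 1 s U (n := n) (by linarith) (by linarith) β hLs s (U'' := U)
    (by linarith)
  nlinarith [hg, hth, mul_nonneg (sub_nonneg.2 hU1) (sub_nonneg.2 hn1), hn2]

end Summit.Ventures.CertifiedManyBodySolver.Certificates

end
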